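import Summits.BirchSwinnertonDyer.BirchSwinnertonDyer.Theorems.AdditiveKolyvaginRoadLevelSystemsCoreConnected
import Summits.BirchSwinnertonDyer.BirchSwinnertonDyer.Theorems.AdditiveKolyvaginRoadKolyvaginPrimitiveAdditiveParityOfLevelInputs
import Summits.BirchSwinnertonDyer.BirchSwinnertonDyer.Theorems.AdditiveKolyvaginRoadEigen
import Summits.BirchSwinnertonDyer.BirchSwinnertonDyer.Theses.AdditiveKolyvaginRoad
import HarnessLib

/-!
# Route `AdditiveKolyvaginRoad`, crux `LevelKolyvaginSystemsAdditive` (item stmt-BirchSwinnertonDyer-21396, KS′):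
# the CONGRUENCE-form producer (W. Zhang Thm 4.3 + the co-level congruence) also rides Howard's full core graph —
# KS′'s conclusion at a ♯ frame from (SRL) + (V) + ONE seed, granted PUB ∕ DUAL and (R′)
# (cell `pub/bsd-wall`, width seat `bsd-wall-akr-p2x-w2` g2; `--supports stmt-BirchSwinnertonDyer-21396`, helper; part 7 of the
# rigidity chain; sibling of `…LevelSystemsOfSeedAtFrame` (part 6, bipartite form))

WHY. Parts 1–6 serve two producer shapes: the BIPARTITE form (odd-level values `λ` with the two Bertolini–Darmon laws two-sided)
rides Howard's full core graph (edges `a — a ∪ {q}`), whose connectivity is DISCHARGED (parts 4–6, modulo (R′) and PUB ∕ DUAL);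
the CONGRUENCE form (w3's (SRL) binder: W. Zhang Thm 4.3 «`loc_{q₁} κ(n) = 0 ⟺ loc_{q₂} κ(n ∪ {q₁,q₂}) = 0`») only rode
RUNGS `a — a ∪ {q₁,q₂}`, whose connectivity is NOT the discharged one (Howard's paths also pass through «V» configurations:
two even levels `m ∪ a`, `m ∪ b` above a common odd level `m`). THIS FILE closes that gap with ONE more congruence a geometric
producer has anyway — (V) «`loc_a κ(m ∪ a) = 0 ⟺ loc_b κ(m ∪ b) = 0`» for `m` odd (both sides are «`λ(m)` is not a unit»:
Bertolini–Darmon's FIRST reciprocity law Thm 4.1 at the two primes) — by DEFINING the odd-level value predicate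
`Λ(m) :≡ ∃ y ∉ m, κ(m ∪ y) detected above y` and checking the two-sided laws (A), (B) of part 1 from (SRL), (V) and a supply
of fresh primes. Then parts 1–6 apply verbatim.

CONTENTS.
* §1 (abstract, ns `…Koly.CoreGraph`): `lawA_of_congruences`, `lawB_of_congruences`, `ne_zero_of_eqvGen_of_congruences`
  (class ⟹ class along core EDGES from (SRL) + (V) + fresh supply).
* §2 (carrier): `ne_zero_of_coreEdges_of_congruences` (placewise (SRL) ∕ (V) binders, fresh supply).
* §3 `nonempty_levelKolyvaginSystemP_of_reciprocity_of_seed_of_published`: KS′'s conclusion at a ♯ frame ⟸ PUB ∧ DUAL ∧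
  even-level classes with the carrier's local axioms ∧ (SRL) ∧ (V) ∧ `selmer_bottom` ∧ ONE non-zero conductor-one class at an
  even level of total canonical rank `≤ 1` ∧ (R′) — w3's `nonempty_levelKolyvaginSystemP_of_reciprocity_of_firstFloor` with
  the first floor (FF) AT EVERY LEVEL replaced by ONE seed + (V) + (R′) (fresh primes come from Čebotarev at the seed).

HONEST FRAMING: theorems only; 0 definitions (the value predicate is inline), 0 named facts, 0 `sorry`; CONDITIONAL on PUB ∕
DUAL, the classes, (SRL), (V), the seed and (R′); closes nothing. BSD is not proved by any of this.

References: [cite: Howard2006Bipartite, Cor. 2.3.5, Prop. 2.4.11, Thm. 2.5.1] [cite: WZhang2014, Thm. 4.3, (4.8), Thm. 7.2, §9]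
[cite: BertoliniDarmon2005, Thm. 4.1, Thm. 4.2].
-/

-- single-conjunct summit: `Summit.BirchSwinnertonDyer.BirchSwinnertonDyer.…` repeats the name by design
set_option linter.dupNamespace false

noncomputable section

open scoped Classical

/-! ## §1 The bipartite laws from the two congruences (abstract) -/

namespace Summit.BirchSwinnertonDyer.Rank1Residual.X11b.Three.Koly.CoreGraph

variable {F : Type*} [Semiring F] {H : Type*} [AddCommGroup H] [Module F H] {Q : Type*} [DecidableEq Q]
  (Sel : Finset Q → Bool → Submodule F H) (T : Q → H → Prop) (κ : Finset Q → H)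

omit [AddCommGroup H] [Module F H] in
/-- **Law (A) from the congruence (SRL) and a fresh prime**, for the INLINE value predicate
`Λ(m) :≡ ∃ y ∉ m, ¬ T y (κ (m ∪ y))`: for `n` even and `q ∉ n`, `κ(n)` is detected above `q` iff `Λ(n ∪ q)`.
[cite: WZhang2014, Thm. 4.3] [cite: BertoliniDarmon2005, Thm. 4.2] -/
theorem lawA_of_congruences
    (hrec : ∀ (n : Finset Q) (q₁ q₂ : Q), q₁ ∉ n → q₂ ∉ insert q₁ n → Even n.card →
      (T q₁ (κ n) ↔ T q₂ (κ (insert q₂ (insert q₁ n)))))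
    (hfresh : ∀ s : Finset Q, ∃ y, y ∉ s) :
    ∀ (n : Finset Q) (q : Q), Even n.card → q ∉ n →
      (¬ T q (κ n) ↔ ∃ y, y ∉ insert q n ∧ ¬ T y (κ (insert y (insert q n)))) := by
  intro n q hn hqn
  constructor
  · intro h
    obtain ⟨y, hy⟩ := hfresh (insert q n)
    exact ⟨y, hy, fun hT ↦ h ((hrec n q y hqn hy hn).mpr hT)⟩
  · rintro ⟨y, hy, hTy⟩ hT
    exact hTy ((hrec n q y hqn hy hn).mp hT)

omit [AddCommGroup H] [Module F H] in
/-- **Law (B) from the co-level congruence (V)**: for `m` odd and `q ∉ m`, `κ(m ∪ q)` is detected above `q` iff `Λ(m)`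
(two classes one level above a common odd level are detected together — both «`λ(m)` is a unit», Bertolini–Darmon Thm. 4.1
at the two primes). [cite: BertoliniDarmon2005, Thm. 4.1] [cite: WZhang2014, (4.8)] -/
theorem lawB_of_congruences
    (hV : ∀ (m : Finset Q) (a b : Q), Odd m.card → a ∉ m → b ∉ m → (T a (κ (insert a m)) ↔ T b (κ (insert b m)))) :
    ∀ (m : Finset Q) (q : Q), Odd m.card → q ∉ m →
      (¬ T q (κ (insert q m)) ↔ ∃ y, y ∉ m ∧ ¬ T y (κ (insert y m))) := by
  intro m q hm hqm
  exact ⟨fun h ↦ ⟨q, hqm, h⟩, fun ⟨y, hy, hTy⟩ hT ↦ hTy ((hV m y q hm hy hqm).mpr hT)⟩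

/-- **Class ⟹ class along Howard's core EDGES from the two congruences** ((SRL) + (V) + fresh primes + bookkeeping +
`κ(n) ∈ Sel_n^{some sign}` at even levels): a non-zero class at one even vertex forces `κ ≠ 0` at every even vertex of its
connected piece of the core graph (edges `b = a ∪ {q}`, the odd end having both canonical spaces zero; inline). Part 1's
`ne_zero_of_eqvGen` with the value predicate defined from the classes. [cite: Howard2006Bipartite, Cor. 2.4.12, Thm. 2.5.1]
[cite: WZhang2014, Thm. 4.3, Thm. 7.2] -/
theorem ne_zero_of_eqvGen_of_congruences
    (hIn : ∀ (n : Finset Q) (q : Q) (μ : Bool) (y : H), q ∉ n → y ∈ Sel n μ → T q y → y ∈ Sel (insert q n) μ)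
    (hOut : ∀ (n : Finset Q) (q : Q) (μ : Bool) (z : H), q ∉ n → z ∈ Sel (insert q n) μ → T q z → z ∈ Sel n μ)
    (hT0 : ∀ q, T q 0)
    (hrec : ∀ (n : Finset Q) (q₁ q₂ : Q), q₁ ∉ n → q₂ ∉ insert q₁ n → Even n.card →
      (T q₁ (κ n) ↔ T q₂ (κ (insert q₂ (insert q₁ n)))))
    (hV : ∀ (m : Finset Q) (a b : Q), Odd m.card → a ∉ m → b ∉ m → (T a (κ (insert a m)) ↔ T b (κ (insert b m))))
    (hfresh : ∀ s : Finset Q, ∃ y, y ∉ s)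
    (hmem : ∀ n : Finset Q, Even n.card → ∃ μ, κ n ∈ Sel n μ) {n₀ n : Finset Q} (hn₀ : Even n₀.card)
    (h0 : κ n₀ ≠ 0) (hn : Even n.card)
    (hpath : Relation.EqvGen (fun a b : Finset Q ↦ ∃ q, q ∉ a ∧ b = insert q a ∧
        (Even a.card → Sel (insert q a) true = ⊥ ∧ Sel (insert q a) false = ⊥) ∧
        (Odd a.card → Sel a true = ⊥ ∧ Sel a false = ⊥)) n₀ n) : κ n ≠ 0 :=
  ne_zero_of_eqvGen Sel T κ (fun m ↦ ∃ y, y ∉ m ∧ ¬ T y (κ (insert y m))) hIn hOut hT0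
    (lawA_of_congruences T κ hrec hfresh) (lawB_of_congruences T κ hV) hmem hn₀ h0 hn hpath

end Summit.BirchSwinnertonDyer.Rank1Residual.X11b.Three.Koly.CoreGraph

/-! ## §2 The carrier -/

namespace Summit.BirchSwinnertonDyer.BirchSwinnertonDyer.Theorems.AdditiveKoly

open WeierstrassCurve NumberField IsDedekindDomain
  Literature.NumberTheory.EllipticCurves Literature.NumberTheory.EllipticCurves.ModularForms
  Literature.NumberTheory.EllipticCurves.Rank1Residual Literature.NumberTheory.GaloisRepresentations Module
  Summit.BirchSwinnertonDyer.Rank1Residual.X11b.Three.Koly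
  Summit.BirchSwinnertonDyer.BirchSwinnertonDyer.Theses.AdditiveKolyvaginRoad

variable (W : WeierstrassCurve ℚ) (K : Type) [Field K] [NumberField K] (p : ℕ) [W.IsGloballyMinimal]
  (c : K ≃ₐ[ℚ] K) [Module (ZMod p) (Vp W K p)]

/-- **Propagation along Howard's core EDGES for level-indexed classes from the two congruences** — (SRL) «`κ(n)` locally trivial
at `v₁ ∣ q₁` ⟺ `κ(n ∪ {q₁,q₂})` locally trivial at `v₂ ∣ q₂`» (`n` even; W. Zhang Thm 4.3) and (V) «`κ(m ∪ a)` locally trivial at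
`v_a ∣ a` ⟺ `κ(m ∪ b)` locally trivial at `v_b ∣ b`» (`m` odd; BD05 Thm 4.1 at two primes) — plus a supply of fresh admissible
primes and `κ(n) ∈ Sel_n^{some sign}` at even `n`: a non-zero class at ONE even level forces `κ ≠ 0` at every even level of its
component of the core graph. [cite: WZhang2014, Thm. 4.3, (4.8)] [cite: BertoliniDarmon2005, Thm. 4.1] [cite: Howard2006Bipartite,
Thm. 2.5.1] -/
theorem ne_zero_of_coreEdges_of_congruences (κ : Finset (AdmQ W K p) → Vp W K p)
    (hrec : ∀ (n : Finset (AdmQ W K p)) (q₁ q₂ : AdmQ W K p), q₁ ∉ n → q₂ ∉ insert q₁ n → Even n.card →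
      ∀ (v₁ v₂ : HeightOneSpectrum (𝓞 K)), ((q₁ : ℕ) : 𝓞 K) ∈ v₁.asIdeal → ((q₂ : ℕ) : 𝓞 K) ∈ v₂.asIdeal →
      (κ n ∈ (W.baseChange K).torsionLocalKer (v₁.adicCompletion K) ((p ^ 1 : ℕ) : ℤ) ↔
        κ (insert q₂ (insert q₁ n)) ∈ (W.baseChange K).torsionLocalKer (v₂.adicCompletion K) ((p ^ 1 : ℕ) : ℤ)))
    (hV : ∀ (m : Finset (AdmQ W K p)) (a b : AdmQ W K p), Odd m.card → a ∉ m → b ∉ m →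
      ∀ (va vb : HeightOneSpectrum (𝓞 K)), ((a : ℕ) : 𝓞 K) ∈ va.asIdeal → ((b : ℕ) : 𝓞 K) ∈ vb.asIdeal →
      (κ (insert a m) ∈ (W.baseChange K).torsionLocalKer (va.adicCompletion K) ((p ^ 1 : ℕ) : ℤ) ↔
        κ (insert b m) ∈ (W.baseChange K).torsionLocalKer (vb.adicCompletion K) ((p ^ 1 : ℕ) : ℤ)))
    (hfresh : ∀ s : Finset (AdmQ W K p), ∃ y, y ∉ s)
    (hmem : ∀ n : Finset (AdmQ W K p), Even n.card → ∃ μ, κ n ∈ SelQP W K p c n μ)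
    {n₀ n : Finset (AdmQ W K p)} (hn₀ : Even n₀.card) (h0 : κ n₀ ≠ 0) (hn : Even n.card)
    (hpath : Relation.EqvGen (fun a b : Finset (AdmQ W K p) ↦ ∃ q, q ∉ a ∧ b = insert q a ∧
        (Even a.card → SelQP W K p c (insert q a) true = ⊥ ∧ SelQP W K p c (insert q a) false = ⊥) ∧
        (Odd a.card → SelQP W K p c a true = ⊥ ∧ SelQP W K p c a false = ⊥)) n₀ n) :
    κ n ≠ 0 :=
  CoreGraph.ne_zero_of_eqvGen_of_congruences (SelQP W K p c)
    (fun (q : AdmQ W K p) (y : Vp W K p) ↦ ∀ v : HeightOneSpectrum (𝓞 K), ((q : ℕ) : 𝓞 K) ∈ v.asIdeal →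
      y ∈ (W.baseChange K).torsionLocalKer (v.adicCompletion K) ((p ^ 1 : ℕ) : ℤ)) κ
    (fun _ _ _ _ hqn hy hT ↦ mem_selQP_insert_of_forall_mem_torsionLocalKer W K p c hqn hy hT)
    (fun _ _ _ _ _ hz hT ↦ mem_selQP_of_mem_selQP_insert_of_forall_mem_torsionLocalKer W K p c hz hT)
    (fun _ _ _ ↦ zero_mem _)
    (fun n q₁ q₂ hq₁ hq₂ hn ↦ forall_mem_torsionLocalKer_iff_of_congr W K p (hrec n q₁ q₂ hq₁ hq₂ hn))
    (fun m a b hm ha hb ↦ forall_mem_torsionLocalKer_iff_of_congr W K p (hV m a b hm ha hb)) hfresh hmem hn₀ h0 hn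
    hpath

/-! ## §3 KS′'s conclusion at a ♯ frame from the two congruences, ONE class seed and (R′), granted PUB ∕ DUAL -/

section Assembly

variable [W.IsElliptic] [NeZero (W.conductorNorm ℤ)] [Fact p.Prime]
  (Dt : ModularParametrizationData W (W.conductorNorm ℤ)) (β : ℤ) (ι : K →+* ℂ)

/-- **KS′'s conclusion at a ♯ additive frame from Zhang-shape classes, the congruences (SRL) + (V), ONE CLASS SEED and (R′),
granted the route's published inputs** — w3's `nonempty_levelKolyvaginSystemP_of_reciprocity_of_firstFloor` with the first
floor (FF) AT EVERY LEVEL (the unprinted anchor + period bridge at `p² ∣ N`) REPLACED by: (V) the co-level congruence (BD05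
Thm 4.1 at two primes), `selmer_bottom` (c(1) a signed Selmer class; vacuous when `c(1) ≡ 0`), ONE non-zero conductor-one class
`κ₀(∅, n₀)` at an even level of total canonical rank `≤ 1`, and (R′) (witness-free one-prime raising; Poitou–Tate). `transport`
by (SRL) (w3), `baseCase` by core-graph connectivity (part 5 `selQP_coreConnected`, parity from PUB ∕ DUAL by part 6) and §2;
the fresh primes come from Čebotarev at the seed (`exists_admQ_notMem_torsionLocalKer`). CONDITIONAL; closes nothing; BSD is not
proved by this. [cite: WZhang2014, Thm. 4.3, (4.8), Lemma 5.3, Prop. 5.4, Thm. 7.2, Lemma 7.3, §8.1, §9] [cite: BertoliniDarmon2005,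
Thm. 3.2, Thm. 4.1] [cite: Howard2006Bipartite, Prop. 2.4.11, Thm. 2.5.1] -/
theorem nonempty_levelKolyvaginSystemP_of_reciprocity_of_seed_of_published (hPUB : PublishedInputsAdditiveKoly)
    (hDual : PublishedDualityInputsAdditiveKoly) (h5 : 5 ≤ p) (hadd : Addv W p) (hsurj : W.HasSurjectiveModNGaloisRep p)
    (hsp : ∀ (ℓ : ℕ) [Fact ℓ.Prime], W.HasMultiplicativeReductionAtPrime ℓ →
      ¬ p ∣ padicValInt ℓ W.minimalDiscriminantInt)
    (htwo : ∃ (ℓ₁ ℓ₂ : ℕ) (_ : Fact ℓ₁.Prime) (_ : Fact ℓ₂.Prime), ℓ₁ ≠ ℓ₂ ∧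
      W.HasMultiplicativeReductionAtPrime ℓ₁ ∧ W.HasMultiplicativeReductionAtPrime ℓ₂)
    (htam : ¬ p ∣ W.tamagawaProduct) (hr : W.analyticRank = 1)
    (hK : IsImaginaryQuadratic K) (hodd : Odd (NumberField.discr K))
    (hH : SatisfiesHeegnerHypothesis (W.conductorNorm ℤ) K)
    (hL : (W.quadraticTwist (NumberField.discr K : ℚ)).entireLFunction 1 ≠ 0)
    (hβ : (4 * (W.conductorNorm ℤ : ℤ)) ∣ β ^ 2 - NumberField.discr K) (hcM : ¬ (p : ℤ) ∣ Dt.c) (hc1 : c ≠ 1)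
    (ε₀ : Finset (AdmQ W K p) → Bool)
    (κ₀ : Finset {ℓ // Zhang2014.IsKolyvaginPrime (W.conductorNorm ℤ) W K p ℓ} → Finset (AdmQ W K p) → Vp W K p)
    (realisation : ∀ m : Finset {ℓ // Zhang2014.IsKolyvaginPrime (W.conductorNorm ℤ) W K p ℓ},
      ∃ d : KolyvaginHeegnerData Dt β ι (∏ ℓ ∈ m, (ℓ : ℕ)), κ₀ m ∅ = d.kolyvaginClass (Fact.out : p.Prime) 1)
    (sign : ∀ n : Finset (AdmQ W K p), n.Nonempty → Even n.card →
      ∀ m : Finset {ℓ // Zhang2014.IsKolyvaginPrime (W.conductorNorm ℤ) W K p ℓ},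
      conjAct W c ((p ^ 1 : ℕ) : ℤ) (κ₀ m n) = sgnP (ε₀ n ^^ Nat.bodd m.card) • κ₀ m n)
    (selmer_off : ∀ n : Finset (AdmQ W K p), n.Nonempty → Even n.card →
      ∀ (m : Finset {ℓ // Zhang2014.IsKolyvaginPrime (W.conductorNorm ℤ) W K p ℓ}) (v : HeightOneSpectrum (𝓞 K)),
      (∀ ℓ ∈ m, ((ℓ : ℕ) : 𝓞 K) ∉ v.asIdeal) → (∀ q ∈ n, ((q : ℕ) : 𝓞 K) ∉ v.asIdeal) →
      κ₀ m n ∈ selmerLocalKer (W.baseChange K) (v.adicCompletion K) ((p ^ 1 : ℕ) : ℤ))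
    (selmer_inf : ∀ n : Finset (AdmQ W K p), n.Nonempty → Even n.card →
      ∀ (m : Finset {ℓ // Zhang2014.IsKolyvaginPrime (W.conductorNorm ℤ) W K p ℓ}) (w : InfinitePlace K),
      κ₀ m n ∈ selmerLocalKer (W.baseChange K) w.Completion ((p ^ 1 : ℕ) : ℤ))
    (toric_on : ∀ n : Finset (AdmQ W K p), n.Nonempty → Even n.card →
      ∀ m : Finset {ℓ // Zhang2014.IsKolyvaginPrime (W.conductorNorm ℤ) W K p ℓ}, ∀ q ∈ n,
      ∀ v : HeightOneSpectrum (𝓞 K),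
      ((q : ℕ) : 𝓞 K) ∈ v.asIdeal → κ₀ m n ∈ toricLocalKer (W.baseChange K) (v.adicCompletion K) ((p ^ 1 : ℕ) : ℤ))
    (transverse_on : ∀ n : Finset (AdmQ W K p), n.Nonempty → Even n.card →
      ∀ m : Finset {ℓ // Zhang2014.IsKolyvaginPrime (W.conductorNorm ℤ) W K p ℓ}, ∀ ℓ ∈ m,
      ∀ v : HeightOneSpectrum (𝓞 K),
      ((ℓ : ℕ) : 𝓞 K) ∈ v.asIdeal → κ₀ m n ∈ transverseLocalKerP W K p ι ℓ v)
    (relation : ∀ n : Finset (AdmQ W K p), n.Nonempty → Even n.card →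
      ∀ (m : Finset {ℓ // Zhang2014.IsKolyvaginPrime (W.conductorNorm ℤ) W K p ℓ})
        (ℓ : {ℓ // Zhang2014.IsKolyvaginPrime (W.conductorNorm ℤ) W K p ℓ}), ℓ ∉ m → ∀ v : HeightOneSpectrum (𝓞 K),
      ((ℓ : ℕ) : 𝓞 K) ∈ v.asIdeal →
      (κ₀ (insert ℓ m) n ∈ (W.baseChange K).torsionLocalKer (v.adicCompletion K) ((p ^ 1 : ℕ) : ℤ) ↔
        κ₀ m n ∈ (W.baseChange K).torsionLocalKer (v.adicCompletion K) ((p ^ 1 : ℕ) : ℤ)))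
    (reciprocity : ∀ (n : Finset (AdmQ W K p)) (q₁ q₂ : AdmQ W K p), q₁ ∉ n → q₂ ∉ insert q₁ n → Even n.card →
      ∀ (m : Finset {ℓ // Zhang2014.IsKolyvaginPrime (W.conductorNorm ℤ) W K p ℓ}) (v₁ v₂ : HeightOneSpectrum (𝓞 K)),
      ((q₁ : ℕ) : 𝓞 K) ∈ v₁.asIdeal → ((q₂ : ℕ) : 𝓞 K) ∈ v₂.asIdeal →
      (κ₀ m n ∈ (W.baseChange K).torsionLocalKer (v₁.adicCompletion K) ((p ^ 1 : ℕ) : ℤ) ↔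
        κ₀ m (insert q₂ (insert q₁ n)) ∈ (W.baseChange K).torsionLocalKer (v₂.adicCompletion K) ((p ^ 1 : ℕ) : ℤ)))
    (colevel : ∀ (n' : Finset (AdmQ W K p)) (a b : AdmQ W K p), Odd n'.card → a ∉ n' → b ∉ n' →
      ∀ (va vb : HeightOneSpectrum (𝓞 K)), ((a : ℕ) : 𝓞 K) ∈ va.asIdeal → ((b : ℕ) : 𝓞 K) ∈ vb.asIdeal →
      (κ₀ ∅ (insert a n') ∈ (W.baseChange K).torsionLocalKer (va.adicCompletion K) ((p ^ 1 : ℕ) : ℤ) ↔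
        κ₀ ∅ (insert b n') ∈ (W.baseChange K).torsionLocalKer (vb.adicCompletion K) ((p ^ 1 : ℕ) : ℤ)))
    (selmer_bottom : ∃ μ : Bool, κ₀ ∅ ∅ ∈ SelQP W K p c ∅ μ)
    (n₀ : Finset (AdmQ W K p)) (hn₀ : Even n₀.card)
    (hcore₀ : finrank (ZMod p) (SelQP W K p c n₀ true) + finrank (ZMod p) (SelQP W K p c n₀ false) ≤ 1)
    (seed : κ₀ ∅ n₀ ≠ 0)
    (hraise : ∀ (m : Finset (AdmQ W K p)) (q : AdmQ W K p) (μ : Bool), q ∉ m →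
      (∀ v : HeightOneSpectrum (𝓞 K), ((q : ℕ) : 𝓞 K) ∈ v.asIdeal → ∀ z : Vp W K p,
        (W.baseChange K).torsionLocMap (v.adicCompletion K) ((p ^ 1 : ℕ) : ℤ) (conjAct W c ((p ^ 1 : ℕ) : ℤ) z) =
          sgnP μ • (W.baseChange K).torsionLocMap (v.adicCompletion K) ((p ^ 1 : ℕ) : ℤ) z) →
      (∀ x ∈ SelQP W K p c m μ, ∀ v : HeightOneSpectrum (𝓞 K), ((q : ℕ) : 𝓞 K) ∈ v.asIdeal →
        x ∈ (W.baseChange K).torsionLocalKer (v.adicCompletion K) ((p ^ 1 : ℕ) : ℤ)) →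
      SelQP W K p c m μ ≤ SelQP W K p c (insert q m) μ ∧
        finrank (ZMod p) (SelQP W K p c (insert q m) μ) = finrank (ZMod p) (SelQP W K p c m μ) + 1) :
    Nonempty (LevelKolyvaginSystemP W K p Dt β ι c) := by
  -- the conductor-one classes lie in the level spaces at every even level
  have hmem : ∀ n : Finset (AdmQ W K p), Even n.card → ∃ μ, κ₀ ∅ n ∈ SelQP W K p c n μ := by
    intro n hn
    rcases n.eq_empty_or_nonempty with rfl | hne
    · exact selmer_bottom
    · refine ⟨ε₀ n, (mem_selQP_iff W K p c n (ε₀ n) _).mpr ⟨?_, selmer_inf n hne hn ∅, fun v hv ↦ ?_,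
        fun q hq v hqv ↦ toric_on n hne hn ∅ q hq v hqv⟩⟩
      · simpa only [Finset.card_empty, Nat.bodd_zero, Bool.xor_false] using sign n hne hn ∅
      · exact selmer_off n hne hn ∅ v (fun ℓ hℓ ↦ absurd hℓ (Finset.notMem_empty ℓ)) hv
  -- fresh admissible primes: Čebotarev at the seed
  obtain ⟨μ₀, hμ₀⟩ := hmem n₀ hn₀
  have hfresh : ∀ s : Finset (AdmQ W K p), ∃ y, y ∉ s := fun s ↦ by
    obtain ⟨q, hq, -⟩ := exists_admQ_notMem_torsionLocalKer W K p c h5 hadd hsurj hK hH hc1 hμ₀ seed s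
    exact ⟨q, hq⟩
  -- parity from the published inputs (akr-p1's odd Selmer rank, read in the `SelQP ∅` currency), connectivity from part 5
  have hp : p.Prime := Fact.out
  have hp2 : p ≠ 2 := by omega
  have hpar : Odd (finrank (ZMod p) (SelQP W K p c ∅ true) + finrank (ZMod p) (SelQP W K p c ∅ false)) := by
    obtain ⟨s, hsodd, hs⟩ := oddSelmerRankAdditive_of_levelInputs hPUB.1 hPUB.2.1 hPUB.2.2.2.2.1 hDual.1 W p K Dt β ι
      h5 hadd hsurj hsp htwo htam hr hK hodd hH hL hβ hcM
    have e1 : ((p ^ 1 : ℕ) : ℤ) = (p : ℤ) := by simp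
    have hs' : Nat.card (selmerGroup (W.baseChange K) ((p ^ 1 : ℕ) : ℤ)) = p ^ s := by rw [e1]; exact hs
    have hcard := natCard_selmer_eq_pow_finrank_selQP_add W K p hp2 hK c (Method2.algEquiv_mul_self_eq_one K hK c)
    rw [hs'] at hcard
    rwa [← Nat.pow_right_injective hp.two_le hcard]
  have hconn := selQP_coreConnected W K p c h5 hadd hsurj hK hH hc1 hraise hpar hcore₀
  refine nonempty_levelKolyvaginSystemP_of_evenLevels W K p c Dt β ι ε₀ κ₀ realisation sign selmer_off selmer_inf
    toric_on transverse_on relation ?_ ?_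
  · -- transport (A2) from (SRL)
    intro n q₁ q₂ hq₁ hq₂ he hbase
    exact exists_ne_zero_of_reciprocity_of_notMem_baseLocusQP W K p κ₀ (reciprocity n q₁ q₂ hq₁ hq₂ he) hbase
  · -- base case (A5) from the seed along Howard's core graph
    intro n hne he h1
    exact ne_zero_of_coreEdges_of_congruences W K p c (κ₀ ∅)
      (fun n q₁ q₂ hq₁ hq₂ hn ↦ reciprocity n q₁ q₂ hq₁ hq₂ hn ∅) colevel hfresh hmem hn₀ seed he (hconn n hne he h1)

end Assembly

end Summit.BirchSwinnertonDyer.BirchSwinnertonDyer.Theorems.AdditiveKoly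

end
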